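import Literature.AlgebraicGeometry.Limits.SmoothProjectiveSpreadPrescribedBase
import HarnessLib

/-!
# The projective model over a PRESCRIBED normal base is smooth, proper, of relative dimension `n` and
# geometrically irreducible over every small enough basic open (EGA IV₃ §8, IV₄ 17.7.8; Stacks 0AY8)

Topic `Literature/AlgebraicGeometry/Limits`. Theorems only. Written by the prover seat
`hodge-nonav-prover-Bx` (g18, cell `hodge-nonav`) for the programme «Q-FAMILY» (memo
`PROGRAMME-Q-FAMILY-Bx-g18.md` §7; `--supports stmt-HodgeConjecture-24190`), route-agnostic: the form of
`exists_smooth_projective_spread_away` (same file topic) in which the model is exposed as ONE projective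
`A`-scheme `f : P ↪ ℙᴺ_A → Spec A` with generic fibre `E`, together with `t₀ ≠ 0` such that the base
change of `f` to `A[1/t]` is proper, smooth of relative dimension `n` and geometrically irreducible for
EVERY non-zero multiple `t` of `t₀` and every model `T` of `A[1/t]`. Consumers who must shrink the base
further (spreading an isomorphism, a section, a non-emptiness) then keep a single model and never re-base.

* `exists_projectiveModel_forall_smooth_away` — for `A` an integrally closed Noetherian domain with
  fraction field `K` and `E` a smooth projective geometrically irreducible `K`-variety of dimension `n`:
  `∃ N P (emb : P ↪ ℙᴺ_A) (gen : E → P) (t₀ ≠ 0)`, `P` irreducible, `E ≅ P ×_A Spec K` (a cartesian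
  square for `f = emb ≫ (ℙᴺ_A → Spec A)`), and for all `t` with `t₀ ∣ t`, `t ≠ 0`, all `T` with
  `IsLocalization.Away t T`: `IsProper`, `SmoothOfRelativeDimension n`, `GeometricallyIrreducible` for
  `pullback.snd f (Spec T → Spec A)`.

Proof: as `exists_smooth_projective_spread_away` (irreducible projective model
`exists_irreducible_projectiveModel`, `LocApprox.exists_forall_smooth_snd` — already uniform in the multiples
of `t₀` —, relative dimension read on `E`, `geometricallyIrreducible_of_genericFibre` over the integrally
closed `A[1/t]`), the localization `T` being an arbitrary model of `A[1/t]` with `T → K` built by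
`IsLocalization.Away.lift`.

## References

* [EGAIV3] A. Grothendieck, J. Dieudonné, EGA IV₃ (1966), Thm. 8.10.5.
* [EGAIV4] EGA IV₄ (1967), Prop. 17.7.8.
* [StacksProject] The Stacks Project, Tags 081I, 0C0C, 0AY8.
-/

noncomputable section

set_option backward.isDefEq.respectTransparency false

universe u

open CategoryTheory CategoryTheory.Limits AlgebraicGeometry TopologicalSpace MvPolynomial
open Literature.AlgebraicGeometry.Morphisms Literature.AlgebraicGeometry.Motives
open Literature.AlgebraicGeometry.HodgeTheory.SpreadingOutQbar

namespace Literature.AlgebraicGeometry.Limits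

attribute [local instance] MvPolynomial.gradedAlgebra

/-- **A projective model over the prescribed normal base, smooth proper of relative dimension `n`
and geometrically irreducible over every small basic open** (EGA IV₃ 8.10.5, IV₄ 17.7.8; Stacks 081I,
0C0C, 0AY8): see the module docstring. [cite: EGAIV3, Thm. 8.10.5] [cite: EGAIV4, Prop. 17.7.8]
[cite: StacksProject, Tag 0AY8] -/
theorem exists_projectiveModel_forall_smooth_away {A K : Type u} [CommRing A] [IsDomain A]
    [IsNoetherianRing A] [IsIntegrallyClosed A] [Field K] [Algebra A K] [IsFractionRing A K]
    {n : ℕ} {E : SchemeOver K} (hE : IsSmoothProjective n E) :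
    ∃ (N : ℕ) (P : Scheme.{u}) (emb : P ⟶ Proj (homogeneousSubmodule (Fin (N + 1)) A))
      (_ : IsClosedImmersion emb) (gen : E.left ⟶ P) (t₀ : A) (_ : t₀ ≠ 0),
      IrreducibleSpace P ∧
      IsPullback gen E.hom (emb ≫ ProjBaseChangeRing.projToSpec (Fin (N + 1)) A)
        (Spec.map (CommRingCat.ofHom (algebraMap A K))) ∧
      ∀ (t : A), t₀ ∣ t → t ≠ 0 → ∀ (T : Type u) [CommRing T] [Algebra A T] [IsLocalization.Away t T],
        IsProper (pullback.snd (emb ≫ ProjBaseChangeRing.projToSpec (Fin (N + 1)) A)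
          (Spec.map (CommRingCat.ofHom (algebraMap A T)))) ∧
        SmoothOfRelativeDimension n (pullback.snd (emb ≫ ProjBaseChangeRing.projToSpec (Fin (N + 1)) A)
          (Spec.map (CommRingCat.ofHom (algebraMap A T)))) ∧
        GeometricallyIrreducible (pullback.snd (emb ≫ ProjBaseChangeRing.projToSpec (Fin (N + 1)) A)
          (Spec.map (CommRingCat.ofHom (algebraMap A T)))) := by
  classical
  -- A. `E` is integral
  haveI := hE.smoothOfRelativeDimension
  haveI : Smooth E.hom := SmoothOfRelativeDimension.smooth n E.hom
  haveI : IsReduced E.left := isReduced_of_smoothOfRelativeDimension E.hom n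
  haveI : GeometricallyIrreducible E.hom := hE.geometricallyIrreducible
  haveI : Subsingleton ↥(Spec (CommRingCat.of K)) :=
    inferInstanceAs (Subsingleton (PrimeSpectrum K))
  haveI : IrreducibleSpace E.left :=
    GeometricallyIrreducible.irreducibleSpace_of_subsingleton (f := E.hom)
  haveI : IsIntegral E.left := isIntegral_of_irreducibleSpace_of_isReduced E.left
  haveI : GeometricallyReduced E.hom := geometricallyReduced_of_smooth E.hom
  haveI : GeometricallyIntegral E.hom :=
    GeometricallyIntegral.of_geometricallyReduced_of_geometricallyIrreducible _
  -- D. an irreducible projective model over `A`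
  haveI : IsNoetherianRing (CommRingCat.of A) := ‹IsNoetherianRing A›
  haveI : IsLocallyNoetherian (Spec (CommRingCat.of A)) :=
    (isLocallyNoetherian_Spec (R := CommRingCat.of A)).mpr ‹_›
  obtain ⟨N', P, emb, hemb, gen, hPirr, HM⟩ := exists_irreducible_projectiveModel A K E hE.isProjectiveOver
  haveI : IsProper (ProjBaseChangeRing.projToSpec (Fin (N' + 1)) A) :=
    ProjBaseChangeRing.isProper_projToSpec _ A
  obtain ⟨f, hf⟩ : ∃ f : P ⟶ Spec (.of A), f = emb ≫ ProjBaseChangeRing.projToSpec (Fin (N' + 1)) A :=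
    ⟨_, rfl⟩
  rw [← hf] at HM
  haveI : IsProper f := by rw [hf]; infer_instance
  haveI : LocallyOfFiniteType f := ‹IsProper f›.toLocallyOfFiniteType
  haveI : QuasiCompact f := inferInstance
  set jK : Spec (.of K) ⟶ Spec (.of A) := Spec.map (CommRingCat.ofHom (algebraMap A K)) with hjK
  -- E1. the model is smooth over `D(t)` for every multiple `t` of some `t₀`
  have hgenSm : Smooth (pullback.snd f jK) := by
    rw [← HM.isoPullback_inv_snd]; infer_instance
  haveI : LocallyOfFinitePresentation (Over.mk f : SchemeOver A).hom :=
    LocallyOfFinitePresentation.iff_locallyOfFiniteType.mpr ‹LocallyOfFiniteType f›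
  haveI : QuasiCompact (Over.mk f : SchemeOver A).hom := ‹QuasiCompact f›
  obtain ⟨t₀, ht₀, H₁⟩ := Limits.LocApprox.exists_forall_smooth_snd (nonZeroDivisors A) K (Over.mk f) hgenSm
  refine ⟨N', P, emb, hemb, gen, t₀, nonZeroDivisors.ne_zero ht₀, hPirr, by rw [← hf]; exact HM, ?_⟩
  intro t ht0t ht0 T _ _ _
  rw [← hf]
  -- the localisation `T ≅ A[1/t]` and the maps `A → T → K`
  haveI : IsDomain T := IsLocalization.isDomain_of_le_nonZeroDivisors (M := Submonoid.powers t) T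
    (powers_le_nonZeroDivisors_of_noZeroDivisors ht0)
  haveI : IsNoetherianRing T := IsLocalization.isNoetherianRing (Submonoid.powers t) T inferInstance
  have hunit : IsUnit (algebraMap A K t) :=
    Ne.isUnit ((IsFractionRing.to_map_eq_zero_iff (K := K)).not.mpr ht0)
  let φ₀ : T →+* K := IsLocalization.Away.lift t hunit
  letI : Algebra T K := φ₀.toAlgebra
  haveI : IsScalarTower A T K :=
    IsScalarTower.of_algebraMap_eq fun r ↦ (IsLocalization.Away.lift_eq t hunit r).symm
  haveI : IsFractionRing T K :=
    IsFractionRing.isFractionRing_of_isDomain_of_isLocalization (Submonoid.powers t) T _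
  -- the family `Y = P ×_A Spec T → Spec T`
  set jT : Spec (.of T) ⟶ Spec (.of A) := Spec.map (CommRingCat.ofHom (algebraMap A T)) with hjT
  haveI : IsOpenImmersion jT := IsOpenImmersion.of_isLocalization t
  set jKT : Spec (.of K) ⟶ Spec (.of T) := Spec.map (CommRingCat.ofHom (algebraMap T K)) with hjKT
  have hjfac : jK = jKT ≫ jT := by
    rw [hjK, hjKT, hjT, ← Spec.map_comp, ← CommRingCat.ofHom_comp, ← IsScalarTower.algebraMap_eq]
  have sqY : IsPullback (pullback.fst f jT) (pullback.snd f jT) f jT := IsPullback.of_hasPullback f jT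
  have hgSm : Smooth (pullback.snd f jT) := H₁ t ht0t T
  -- `E = Y ×_T Spec K`
  have HM' : IsPullback gen E.hom f (jKT ≫ jT) := hjfac ▸ HM
  let ℓE : E.left ⟶ pullback f jT :=
    sqY.lift gen (E.hom ≫ jKT) (by rw [Category.assoc]; exact HM'.w)
  have hℓ₁ : ℓE ≫ pullback.fst f jT = gen := sqY.lift_fst _ _ _
  have hℓ₂ : ℓE ≫ pullback.snd f jT = E.hom ≫ jKT := sqY.lift_snd _ _ _
  have SqE : IsPullback ℓE E.hom (pullback.snd f jT) jKT :=
    IsPullback.of_right (by rw [hℓ₁]; exact HM') hℓ₂ sqY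
  -- `Y` is irreducible, hence smooth of one relative dimension, which is `n` (compare on `E`)
  haveI : Nonempty ↥(pullback f jT) := ⟨ℓE.base (Classical.arbitrary E.left)⟩
  haveI : IrreducibleSpace ↥(pullback f jT) := (pullback.fst f jT).isOpenEmbedding.irreducibleSpace
  haveI : Smooth (pullback.snd f jT) := hgSm
  obtain ⟨d, hd⟩ := exists_smoothOfRelativeDimension_of_smooth (pullback.snd f jT)
  haveI := smoothOfRelativeDimension_isStableUnderBaseChange (n := d)
  have hdE : SmoothOfRelativeDimension d E.hom := MorphismProperty.of_isPullback SqE hd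
  obtain rfl : n = d :=
    (AbelianVarietyProofs.eq_of_smoothOfRelativeDimension E.hom hdE hE.smoothOfRelativeDimension).symm
  -- E3. all fibres are geometrically irreducible (Stacks 0AY8): `T` is integrally closed
  haveI : IsIntegrallyClosed T := isIntegrallyClosed_of_isLocalization T (Submonoid.powers t)
    (powers_le_nonZeroDivisors_of_noZeroDivisors ht0)
  haveI : GeometricallyIntegral
      ((pullback.snd f jT).fiberToSpecResidueField (genericPoint (Spec (.of T)))) :=
    of_isPullback_genericFibre (R := T) (K := K) @GeometricallyIntegral (pullback.snd f jT) SqE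
      inferInstance
  haveI : IsProper (pullback.snd f jT) := inferInstance
  haveI := hd
  have hgi : GeometricallyIrreducible (pullback.snd f jT) :=
    geometricallyIrreducible_of_genericFibre (pullback.snd f jT) n
  exact ⟨inferInstance, hd, hgi⟩

end Literature.AlgebraicGeometry.Limits

end
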